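import Summits.AtomisticToContinuum.Crystallization.Theorems.SlackRigidity.Negative.WitnessBasics
import Summits.AtomisticToContinuum.Crystallization.Theorems.OnePercentCertificate.Negative.ValueLowerBound
import Literature.MathematicalPhysics.StatisticalMechanics.LennardJonesClusters

/-!
# Line `c-layer-witness-strictness` for crux `SlackRigidity` (stmt-AtomisticToContinuum-11960):
# rooting, part 1 — dictionary, total slack, double counting

Helper lemmas for the registered stub `stub_rooting` of the line skeleton
`Cruxes/SlackRigidity/Lines/c-layer-witness-strictness.lean` (lead prover):

* `good_iff_rootMatched_image` — the crux's matching predicate `Good P R ε x i` is literally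
  two-way root-matching of the recentred point set `(· − x i) '' range x`;
* `sum_star_add_interactionEnergy_le` — TOTAL SLACK: for an injective configuration and a
  three-cone split `V_LJ = g + U + f` on `(0,∞)` with `f` of positive type and a star functional
  `F` certifying `Σ_i F(star_i) ≤ Σ_{i<j} g + cM`, one has
  `Σ_i F(star_i) + Σ_{i<j} U(r_ij) ≤ 𝓔_LJ(z) + (c + f(0)/2)·M`;
* `sum_sum_filter_le_mul_sum` — DOUBLE COUNTING on a `1/3`-separated configuration: summing a
  nonnegative weight `τ_j` over the `L`-balls about all particles costs at most the packing factor
  `(6L+1)³`;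
* `card_filter_mul_le_sum` — Markov's inequality for a nonnegative weight.

All elementary ([folklore]); inputs: `interactionEnergy_lennardJones_split`,
`neg_card_mul_le_interactionEnergy_of_posType` (Theorems/OnePercentCertificate/Negative),
`card_le_of_separated_of_dist_le` (LennardJonesClusters).
-/

noncomputable section

namespace Summit.AtomisticToContinuum.Crystallization.Theorems.CLayerWitnessRooting

open scoped BigOperators
open Literature.MathematicalPhysics.StatisticalMechanics
open Summit.AtomisticToContinuum.Crystallization.Theorems.SlackRigidityNegative (E3 Good)

/-! ## The dictionary `Good ↔ root-matched recentred range` -/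

/-- Membership in the recentred range: `q ∈ (· − x i) '' range x ↔ ∃ j, q = x j − x i`. [folklore] -/
theorem mem_image_sub_range_iff {N : ℕ} (x : Fin N → E3) (i : Fin N) (q : E3) :
    q ∈ (fun z => z - x i) '' Set.range x ↔ ∃ j : Fin N, q = x j - x i := by
  constructor
  · rintro ⟨z, ⟨j, rfl⟩, rfl⟩
    exact ⟨j, rfl⟩
  · rintro ⟨j, rfl⟩
    exact ⟨x j, ⟨j, rfl⟩, rfl⟩

/-- Recentred distances: `dist (x j − x i) v = dist (x j) (x i + v)`. [folklore] -/
theorem dist_sub_eq_dist_add (u w v : E3) : dist (u - w) v = dist u (w + v) := by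
  rw [dist_eq_norm, dist_eq_norm, sub_sub]

/-- **Dictionary.** The crux's predicate `Good P R ε x i` (two-way `ε`-matching of `B_R(x i)` with
`x i + A (P.points ∩ B_R)`) is two-way root-matching at `(R, ε)` of the recentred point set
`(· − x i) '' range x`. [folklore] -/
theorem good_iff_rootMatched_image :
    ∀ (P : PeriodicConfiguration 3) (R ε : ℝ) {N : ℕ} (x : Fin N → E3) (i : Fin N),
    Good P R ε x i ↔ ∃ A : E3 →ₗᵢ[ℝ] E3,
      (∀ p ∈ P.points, ‖p‖ ≤ R → ∃ q ∈ (fun z => z - x i) '' Set.range x, dist q (A p) ≤ ε) ∧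
      (∀ q ∈ (fun z => z - x i) '' Set.range x, ‖q‖ ≤ R →
        ∃ p ∈ P.points, dist q (A p) ≤ ε) := by
  intro P R ε N x i
  constructor
  · rintro ⟨A, ha, hb⟩
    refine ⟨A, fun p hp hpR => ?_, fun q hq hqR => ?_⟩
    · obtain ⟨j, hj⟩ := ha p hp hpR
      exact ⟨x j - x i, (mem_image_sub_range_iff x i _).2 ⟨j, rfl⟩,
        by rwa [dist_sub_eq_dist_add]⟩
    · obtain ⟨j, rfl⟩ := (mem_image_sub_range_iff x i q).1 hq
      have hji : dist (x j) (x i) ≤ R := by rwa [dist_eq_norm]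
      obtain ⟨p, hp, hjp⟩ := hb j hji
      exact ⟨p, hp, by rwa [dist_sub_eq_dist_add]⟩
  · rintro ⟨A, ha, hb⟩
    refine ⟨A, fun p hp hpR => ?_, fun j hj => ?_⟩
    · obtain ⟨q, hq, hqp⟩ := ha p hp hpR
      obtain ⟨j, rfl⟩ := (mem_image_sub_range_iff x i q).1 hq
      exact ⟨j, by rwa [← dist_sub_eq_dist_add]⟩
    · have hq : x j - x i ∈ (fun z => z - x i) '' Set.range x :=
        (mem_image_sub_range_iff x i _).2 ⟨j, rfl⟩
      have hqR : ‖x j - x i‖ ≤ R := by rwa [← dist_eq_norm]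
      obtain ⟨p, hp, hjp⟩ := hb _ hq hqR
      exact ⟨p, hp, by rwa [← dist_sub_eq_dist_add]⟩

/-! ## Total slack of a certified split -/

/-- **Total slack.** For a three-cone split `V_LJ = g + U + f` on `(0,∞)` with `f` of positive type
and a star functional `F` with `Σ_i F(star_i) ≤ Σ_{i<j} g + c·M` on injective configurations, every
injective `z` satisfies `Σ_i F(star_i) + Σ_{i<j} U(r_ij) ≤ 𝓔_LJ(z) + (c + f(0)/2)·M` (split termwise
at positive distances; Bochner with all weights `1`: `Σ_{i<j} f ≥ −M f(0)/2`). [cite: Ruelle1969, §3.2 Prop. 3.2.7] -/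
theorem sum_star_add_interactionEnergy_le {c ρ' : ℝ} {g U f : ℝ → ℝ} {F : Set E3 → ℝ}
    (hsplit : ∀ r : ℝ, 0 < r → lennardJones r = g r + U r + f r)
    (hf : ∀ (n : ℕ) (y : Fin n → E3) (w : Fin n → ℝ),
      0 ≤ ∑ i, ∑ j, w i * w j * f (dist (y i) (y j)))
    (hstar : ∀ (N : ℕ) (x : Fin N → E3), Function.Injective x →
      ∑ i, F (((fun z => z - x i) '' Set.range x) ∩ Metric.closedBall 0 ρ') ≤
        interactionEnergy g x + c * N)
    {M : ℕ} {z : Fin M → E3} (hz : Function.Injective z) :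
    ∑ i, F (((fun w => w - z i) '' Set.range z) ∩ Metric.closedBall 0 ρ') +
        interactionEnergy U z ≤
      interactionEnergy lennardJones z + (c + f 0 / 2) * M := by
  have h1 := interactionEnergy_lennardJones_split hsplit hz
  have h2 := neg_card_mul_le_interactionEnergy_of_posType hf z
  have h3 := hstar M z hz
  nlinarith [h1, h2, h3]

/-! ## Double counting and Markov on separated configurations -/

/-- A `δ`-separated configuration (`δ > 0`) is injective. [folklore] -/
theorem injective_of_separated {M : ℕ} {z : Fin M → E3} {δ : ℝ} (hδ : 0 < δ)
    (hsep : ∀ i j : Fin M, i ≠ j → δ ≤ dist (z i) (z j)) : Function.Injective z := by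
  intro i j hij
  by_contra hne
  have h := hsep i j hne
  rw [hij, dist_self] at h
  linarith

/-- Packing count: in a `1/3`-separated configuration at most `(6L+1)³` particles lie within
distance `L` of a given particle. [folklore] -/
theorem card_filter_dist_le {M : ℕ} {z : Fin M → E3}
    (hsep : ∀ i j : Fin M, i ≠ j → (1 / 3 : ℝ) ≤ dist (z i) (z j)) {L : ℝ} (hL : 0 ≤ L)
    (p : E3) :
    ((Finset.univ.filter fun i => dist (z i) p ≤ L).card : ℝ) ≤ (6 * L + 1) ^ 3 := by
  classical
  have hinj : Function.Injective z := injective_of_separated (by norm_num) hsep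
  set T := Finset.univ.filter fun i => dist (z i) p ≤ L with hT
  have hcard : ((T.image z).card : ℝ) = T.card := by
    rw [Finset.card_image_of_injective _ hinj]
  rw [← hcard]
  have h := card_le_of_separated_of_dist_le (T.image z) p (by norm_num : (0 : ℝ) < 1 / 3) hL
    ?_ ?_
  · rw [finrank_euclideanSpace_fin] at h
    convert h using 2
    ring
  · intro q hq
    obtain ⟨i, hi, rfl⟩ := Finset.mem_image.1 hq
    exact (Finset.mem_filter.1 hi).2
  · intro q hq q' hq' hne
    obtain ⟨i, -, rfl⟩ := Finset.mem_image.1 hq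
    obtain ⟨j, -, rfl⟩ := Finset.mem_image.1 hq'
    exact hsep i j fun h => hne (by rw [h])

/-- **Double counting.** On a `1/3`-separated configuration, for a nonnegative weight `τ`,
`Σ_i Σ_{j : dist(z j, z i) ≤ L} τ_j ≤ (6L+1)³ Σ_j τ_j`. [folklore] -/
theorem sum_sum_filter_le_mul_sum {M : ℕ} {z : Fin M → E3}
    (hsep : ∀ i j : Fin M, i ≠ j → (1 / 3 : ℝ) ≤ dist (z i) (z j)) {τ : Fin M → ℝ}
    (hτ : ∀ j, 0 ≤ τ j) {L : ℝ} (hL : 0 ≤ L) :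
    ∑ i, ∑ j ∈ Finset.univ.filter (fun j => dist (z j) (z i) ≤ L), τ j ≤
      (6 * L + 1) ^ 3 * ∑ j, τ j := by
  classical
  -- rewrite as a sum over `j` of `τ j · #{i : dist (z j) (z i) ≤ L}`
  have hswap : ∑ i, ∑ j ∈ Finset.univ.filter (fun j => dist (z j) (z i) ≤ L), τ j =
      ∑ j, ((Finset.univ.filter fun i => dist (z j) (z i) ≤ L).card : ℝ) * τ j := by
    have h1 : ∀ i : Fin M, ∑ j ∈ Finset.univ.filter (fun j => dist (z j) (z i) ≤ L), τ j =
        ∑ j, if dist (z j) (z i) ≤ L then τ j else 0 := fun i => by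
      rw [Finset.sum_filter]
    simp_rw [h1]
    rw [Finset.sum_comm]
    refine Finset.sum_congr rfl fun j _ => ?_
    rw [← Finset.sum_filter, Finset.sum_const, nsmul_eq_mul]
  rw [hswap, Finset.mul_sum]
  refine Finset.sum_le_sum fun j _ => ?_
  have hc : ((Finset.univ.filter fun i => dist (z j) (z i) ≤ L).card : ℝ) ≤ (6 * L + 1) ^ 3 := by
    have := card_filter_dist_le hsep hL (z j)
    convert this using 4 with i
    rw [dist_comm]
  exact mul_le_mul_of_nonneg_right hc (hτ j)

/-- **Markov.** For a nonnegative weight `σ` and `η > 0`,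
`η · #{i : η < σ_i} ≤ Σ_i σ_i`. [folklore] -/
theorem card_filter_mul_le_sum {M : ℕ} {σ : Fin M → ℝ} (hσ : ∀ i, 0 ≤ σ i) (η : ℝ) :
    η * ((Finset.univ.filter fun i => η < σ i).card : ℝ) ≤ ∑ i, σ i := by
  classical
  calc η * ((Finset.univ.filter fun i => η < σ i).card : ℝ)
      = ∑ _i ∈ Finset.univ.filter (fun i => η < σ i), η := by
        rw [Finset.sum_const, nsmul_eq_mul, mul_comm]
    _ ≤ ∑ i ∈ Finset.univ.filter (fun i => η < σ i), σ i :=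
        Finset.sum_le_sum fun i hi => (Finset.mem_filter.1 hi).2.le
    _ ≤ ∑ i, σ i :=
        Finset.sum_le_sum_of_subset_of_nonneg (Finset.filter_subset _ _) fun i _ _ => hσ i

end Summit.AtomisticToContinuum.Crystallization.Theorems.CLayerWitnessRooting

end
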